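import Literature.AlgebraicGeometry.Surfaces.GeometricGenusOneAssociatedK3Surface
import Literature.AlgebraicGeometry.HodgeTheory.HodgeTypeProjectors
import Literature.AlgebraicGeometry.HodgeTheory.HodgeTypeExteriorProduct
import Literature.AlgebraicGeometry.HodgeTheory.HodgeTypeConjugation
import Literature.AlgebraicGeometry.HodgeTheory.AlgebraicClassesHodgeTypeHolds
import Literature.NumberTheory.Transcendental.DeRhamTheoremMultiplicative
import HarnessLib

/-!
# The inverse of a cohomological isogeny of surfaces is a cohomological isogeny (Morrison 1987, §1)

Topic `Literature/AlgebraicGeometry/Surfaces`; namespace `Literature.AlgebraicGeometry.Surfaces`.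
Theorem-only companion of `Surfaces/GeometricGenusOneAssociatedK3Surface` (carriers
`transcendentalSubspace`, `IsCohomologicalIsogeny`): no definition, no named fact (D-0026).
Requested by cell hodge-nonav (planner p1 g13, memo ROUTE-P1L §2 "S-inv", the support input
`InverseIsogeny` of the `p_g = 1` ladder assembly `hc4SelfProductPgOne_of'`).

Morrison, *Isogenies between algebraic surfaces with geometric genus one*, Tokyo J. Math. 10 (1987),
§1 Definition (p. 181): a cohomological isogeny is "an isomorphism of rational Hodge structures
`T(X, ℚ) → T(Y, ℚ)`". An isomorphism of rational Hodge structures has an inverse which is again one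
(Voisin, *Hodge Theory I*, §7.3.1 — morphisms of Hodge structures; the bigrading pieces of an
isomorphism of bigraded objects correspond). The tree renders a cohomological isogeny by a
`ℂ`-linear `g : H²(X(ℂ); ℂ) → H²(Y(ℂ); ℂ)` whose restriction to `T(X) ⊗ ℂ` is bijective onto
`T(Y) ⊗ ℂ`, carries rational classes to rational classes and onto them, and preserves every Hodge
type `(i, j)`; the present file proves that such a `g` has an inverse of the same kind on the
transcendental parts, for `X`, `Y` smooth projective surfaces:

* §1 `typeProj_mem_transcendentalSubspace` — **`T(X) ⊗ ℂ` is a sub-Hodge structure**: the Hodge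
  components `π_{(p,q)} a` of a class `a ∈ T(X) ⊗ ℂ = NS(X)^⊥` lie in `T(X) ⊗ ℂ` (Néron–Severi
  classes are of type `(1,1)` — the tree's THEOREM `isOfHodgeType_of_mem_algebraicClasses_of_isSmoothProjective`;
  cup product is bigraded — the tree's `cupPreservesHodgeType_of_multiplicative_deRham` with de
  Rham's theorem `exists_deRhamIsoFamily_holds`; so `c ∪ π_{(p,q)} a = π_{(p+1,q+1)}(c ∪ a) = 0`,
  `HodgeModel.lefschetzOperator_typeProj`). [Huybrechts, *Lectures on K3 surfaces*, Ch. 3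
  Lemma 3.1: `T(X)` is the minimal sub-Hodge structure containing `H^{2,0}`; here only "sub-Hodge
  structure" is used and proved.]
* §2 `IsCohomologicalIsogeny.isOfHodgeType_of_map` — a cohomological isogeny REFLECTS Hodge types on
  `T(X) ⊗ ℂ` (decompose `a`, transport the decomposition along `g`, uniqueness of the Hodge
  decomposition of `g a`, injectivity of `g` on `T(X) ⊗ ℂ`).
* §3 **`IsCohomologicalIsogeny.exists_inverse`**: there is a `ℂ`-linear `g'` with
  `IsCohomologicalIsogeny Y X g'`, `g' (g a) = a` on `T(X) ⊗ ℂ` and `g (g' b) = b` on `T(Y) ⊗ ℂ`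
  (`g'` = the inverse of `g|_{T(X)}` on `T(Y) ⊗ ℂ`, extended by a linear projection onto
  `T(Y) ⊗ ℂ`; its values off `T(Y) ⊗ ℂ` are irrelevant, as in the definition); packaged as the
  cell's Prop shape `inverseIsogeny` (= ROUTE-P1L Sketch `InverseIsogeny`, now a theorem).

## References

* [Morrison1987Isogenies] D. R. Morrison, Isogenies between algebraic surfaces with geometric genus
  one, Tokyo J. Math. 10 (1987) 179–187, §1 Definition (p. 181).
* [VoisinHodgeI2002] C. Voisin, Hodge Theory and Complex Algebraic Geometry I, CUP 2002, §7.1.1,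
  §7.3.1, Thm. 6.18, Rem. 6.27.
* [Huybrechts2016K3] D. Huybrechts, Lectures on K3 Surfaces, CUP 2016, Ch. 3 Lemma 3.1.
-/

noncomputable section

open CategoryTheory
open Literature.AlgebraicTopology.SingularHomology
open Literature.AlgebraicGeometry.HodgeTheory

namespace Literature.AlgebraicGeometry.Surfaces

variable {X Y : Motives.SchemeOver ℂ}

/-! ## §1 The transcendental subspace is a sub-Hodge structure -/

section SubHodge

/-- **Cup product with a Néron–Severi class shifts Hodge types by `(1,1)`** (read in a Hodge model
`A` of the smooth projective surface `X`): `c ∈ NS(X)` is algebraic, hence of type `(1,1)` (Voisin I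
Prop. 11.20, the tree's `isOfHodgeType_of_mem_algebraicClasses_of_isSmoothProjective`), and the cup
product adds Hodge types (Voisin I §7.1.2, the tree's `cupPreservesHodgeType_of_multiplicative_deRham`
with de Rham's theorem). [cite: VoisinHodgeI2002, §7.1.2 and §11.1.2 Prop. 11.20] -/
theorem lefschetzOperator_mem_typePiece_of_mem_neronSeveriGroup (hX : Motives.IsSmoothProjective 2 X)
    (A : HodgeModel 2 X) {c : complexBetti X (2 * 1)} (hc : c ∈ neronSeveriGroup X)
    (k l : ℕ) (hkl : 2 + k = l) (pq : ↥(Finset.HasAntidiagonal.antidiagonal k)) (x : complexBetti X k)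
    (hx : x ∈ A.typePiece k pq) :
    Literature.Geometry.Kaehler.lefschetzOperator c hkl x ∈ A.typePiece l (HodgeModel.typeShift hkl pq) := by
  have hI := hodgePQ_independent_of_hodgeModel_holds
  have hc11 : IsOfHodgeType 2 X (2 * 1) 1 1 c :=
    isOfHodgeType_of_mem_algebraicClasses_of_isSmoothProjective hX 1 hc.2
  have hx' : IsOfHodgeType 2 X k pq.1.1 pq.1.2 x := A.isOfHodgeType_of_mem_typePiece hx
  have hcup : IsOfHodgeType 2 X l (1 + pq.1.1) (1 + pq.1.2) (cupProduct hkl c x) :=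
    cupPreservesHodgeType_of_multiplicative_deRham
      (fun E _ _ _ ↦ Literature.NumberTheory.Transcendental.exists_deRhamIsoFamily_holds E) hX hkl hc11 hx'
  rw [Literature.Geometry.Kaehler.lefschetzOperator_apply]
  have h1 : 1 + pq.1.1 = pq.1.1 + 1 := add_comm _ _
  have h2 : 1 + pq.1.2 = pq.1.2 + 1 := add_comm _ _
  rw [h1, h2] at hcup
  exact A.mem_typePiece_of_isOfHodgeType hI hX _ hcup

/-- **`T(X) ⊗ ℂ` is a sub-Hodge structure of `H²(X(ℂ); ℂ)`**: for a smooth projective surface `X`,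
a Hodge model `A` and `a ∈ T(X) ⊗ ℂ = NS(X)^⊥`, every Hodge component `π_{(p,q)} a` lies in
`T(X) ⊗ ℂ` — for `c ∈ NS(X)`, `c ∪ π_{(p,q)} a = π_{(p+1,q+1)} (c ∪ a) = π_{(p+1,q+1)} 0 = 0`
(`HodgeModel.lefschetzOperator_typeProj`, Voisin I Rem. 6.27). Huybrechts Ch. 3 Lemma 3.1 ("`T(X)`
is a sub-Hodge structure"). [cite: Huybrechts2016K3, Ch. 3 Lemma 3.1] [cite: VoisinHodgeI2002, §6.2.3 Rem. 6.27 and §7.1.1] -/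
theorem typeProj_mem_transcendentalSubspace (hX : Motives.IsSmoothProjective 2 X) (A : HodgeModel 2 X)
    (pq : ↥(Finset.HasAntidiagonal.antidiagonal (2 * 1))) {a : complexBetti X (2 * 1)}
    (ha : a ∈ transcendentalSubspace X) : A.typeProj (2 * 1) pq a ∈ transcendentalSubspace X := by
  rw [mem_transcendentalSubspace_iff] at ha ⊢
  intro c hc
  have hkl : 2 + 2 * 1 = 2 * 2 := by norm_num
  have key := A.lefschetzOperator_typeProj
    (lefschetzOperator_mem_typePiece_of_mem_neronSeveriGroup hX A hc) hkl pq a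
  rw [Literature.Geometry.Kaehler.lefschetzOperator_apply,
    Literature.Geometry.Kaehler.lefschetzOperator_apply] at key
  have h0 : cupProduct hkl c a = 0 := ha c hc
  rw [h0, map_zero] at key
  exact key

end SubHodge

/-! ## §2 A cohomological isogeny reflects Hodge types on the transcendental part -/

section Reflect

variable {g : complexBetti X (2 * 1) →ₗ[ℂ] complexBetti Y (2 * 1)}

/-- Off the antidiagonal there are no classes: a class of type `(i, j)` with `i + j ≠ k` is zero
(the piece `H^{i,j}` of `Hᵏ` of a Hodge model is `⊥`). [cite: VoisinHodgeI2002, §6.1.3 and §7.1.1] -/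
theorem eq_zero_of_isOfHodgeType_of_add_ne {n k i j : ℕ} {Z : Motives.SchemeOver ℂ}
    {c : complexBetti Z k} (hc : IsOfHodgeType n Z k i j c) (hij : i + j ≠ k) : c = 0 := by
  obtain ⟨M, hM⟩ := hc
  have hbot : M.hodgePQ k i j = ⊥ :=
    (M.hodgePQ_eq_bot_iff k i j).2 (Literature.NumberTheory.Transcendental.hodgePQ_eq_bot_of_ne hij)
  rw [hbot, Submodule.mem_bot] at hM
  exact M.pullback_injective k (by rw [hM, map_zero])

/-- **A cohomological isogeny reflects Hodge types on `T(X) ⊗ ℂ`**: if `a ∈ T(X) ⊗ ℂ` and `g a`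
is of type `(i, j)`, then `a` is of type `(i, j)`. Decompose `a = Σ π_{(p,q)} a` with transcendental
components (§1); `g a = Σ g(π_{(p,q)} a)` is then a Hodge decomposition of `g a` (`g` preserves types
on `T(X)`), so by uniqueness `g(π_{(p,q)} a) = π_{(p,q)}(g a)`, which vanishes for `(p,q) ≠ (i,j)`;
`g` being injective on `T(X) ⊗ ℂ`, `π_{(p,q)} a = 0` for `(p,q) ≠ (i,j)` and `a = π_{(i,j)} a`. (An
isomorphism of Hodge structures has an inverse morphism of Hodge structures, Voisin I §7.3.1.)
[cite: Morrison1987Isogenies, §1 Definition (p. 181)] [cite: VoisinHodgeI2002, §7.3.1 and Thm. 6.18] -/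
theorem IsCohomologicalIsogeny.isOfHodgeType_of_map (hX : Motives.IsSmoothProjective 2 X)
    (hY : Motives.IsSmoothProjective 2 Y) (h : IsCohomologicalIsogeny X Y g) {i j : ℕ}
    {a : complexBetti X (2 * 1)} (ha : a ∈ transcendentalSubspace X)
    (hga : IsOfHodgeType 2 Y (2 * 1) i j (g a)) : IsOfHodgeType 2 X (2 * 1) i j a := by
  classical
  have hI := hodgePQ_independent_of_hodgeModel_holds
  obtain ⟨A⟩ := nonempty_hodgeModel_holds.nonempty hX
  obtain ⟨B⟩ := nonempty_hodgeModel_holds.nonempty hY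
  have hinj : ∀ x ∈ transcendentalSubspace X, g x = 0 → x = 0 := fun x hx hx0 ↦
    h.bijOn.injOn hx (Submodule.zero_mem (transcendentalSubspace X)) (by rw [hx0, map_zero])
  by_cases hij : i + j = 2 * 1
  swap
  · -- off the antidiagonal `g a = 0`, hence `a = 0`
    have ha0 : a = 0 := hinj a ha (eq_zero_of_isOfHodgeType_of_add_ne hga hij)
    rw [ha0]
    exact IsOfHodgeType.zero A _ _ _
  obtain ⟨ij, hij'⟩ : ∃ ij : ↥(Finset.HasAntidiagonal.antidiagonal (2 * 1)), ij.1 = (i, j) :=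
    ⟨⟨(i, j), Finset.HasAntidiagonal.mem_antidiagonal.2 hij⟩, rfl⟩
  have hi : ij.1.1 = i := by rw [hij']
  have hj : ij.1.2 = j := by rw [hij']
  -- the transported decomposition of `g a`
  set y : ↥(Finset.HasAntidiagonal.antidiagonal (2 * 1)) → complexBetti Y (2 * 1) :=
    fun pq ↦ g (A.typeProj (2 * 1) pq a) with hy_def
  have hy : ∀ pq, y pq ∈ B.typePiece (2 * 1) pq := fun pq ↦
    B.mem_typePiece_of_isOfHodgeType hI hY pq.2
      (h.isOfHodgeType_map (typeProj_mem_transcendentalSubspace hX A pq ha)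
        (A.isOfHodgeType_of_mem_typePiece (A.typeProj_mem (2 * 1) pq a)))
  have hsum : ∑ pq, y pq = g a := by
    simp only [hy_def]
    rw [← map_sum, A.sum_typeProj]
  have hproj : ∀ pq, B.typeProj (2 * 1) pq (g a) = y pq := fun pq ↦
    B.typeProj_eq_of_sum_eq (y := y) hy hsum pq
  -- `g a` lies in the `(i,j)` piece, so the other projections vanish
  have hgaB : g a ∈ B.typePiece (2 * 1) ij := by
    refine B.mem_typePiece_of_isOfHodgeType hI hY ij.2 ?_
    rw [hi, hj]
    exact hga
  have hvanish : ∀ pq, pq ≠ ij → A.typeProj (2 * 1) pq a = 0 := by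
    intro pq hpq
    refine hinj _ (typeProj_mem_transcendentalSubspace hX A pq ha) ?_
    have h0 : B.typeProj (2 * 1) pq (g a) = 0 := B.typeProj_apply_of_mem_ne (Ne.symm hpq) hgaB
    rw [hproj pq] at h0
    exact h0
  -- hence `a = π_{(i,j)} a`, of type `(i,j)`
  have haeq : A.typeProj (2 * 1) ij a = a := by
    have hs := A.sum_typeProj (2 * 1) a
    rw [Finset.sum_eq_single ij (fun pq _ hpq ↦ hvanish pq hpq)
      (fun hnot ↦ absurd (Finset.mem_univ _) hnot)] at hs
    exact hs
  have hmem : a ∈ A.typePiece (2 * 1) ij := by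
    rw [← haeq]
    exact A.typeProj_mem (2 * 1) ij a
  have htyp : IsOfHodgeType 2 X (2 * 1) ij.1.1 ij.1.2 a := A.isOfHodgeType_of_mem_typePiece hmem
  rw [hi, hj] at htyp
  exact htyp

end Reflect

/-! ## §3 The inverse isogeny -/

section Inverse

variable {g : complexBetti X (2 * 1) →ₗ[ℂ] complexBetti Y (2 * 1)}

/-- **The inverse of a cohomological isogeny** (Morrison §1: a cohomological isogeny is an
ISOMORPHISM of rational Hodge structures `T(X, ℚ) → T(Y, ℚ)`; its inverse is one from `Y` to `X`).
For smooth projective surfaces `X`, `Y` and `g` a cohomological isogeny from `X` to `Y` there is a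
`ℂ`-linear `g' : H²(Y(ℂ); ℂ) → H²(X(ℂ); ℂ)` which is a cohomological isogeny from `Y` to `X` and is
inverse to `g` on the transcendental parts: `g' (g a) = a` for `a ∈ T(X) ⊗ ℂ`, `g (g' b) = b` for
`b ∈ T(Y) ⊗ ℂ`. Construction: invert the bijection `g|_{T(X)} : T(X) ⊗ ℂ ≃ T(Y) ⊗ ℂ` and precompose
with a linear projection of `H²(Y(ℂ); ℂ)` onto `T(Y) ⊗ ℂ`; rationality is carried back because `g` is
onto the rational classes of `T(Y)`; Hodge types by `isOfHodgeType_of_map` (§2).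
[cite: Morrison1987Isogenies, §1 Definition (p. 181)] [cite: VoisinHodgeI2002, §7.3.1] -/
theorem IsCohomologicalIsogeny.exists_inverse (hX : Motives.IsSmoothProjective 2 X)
    (hY : Motives.IsSmoothProjective 2 Y) (h : IsCohomologicalIsogeny X Y g) :
    ∃ g' : complexBetti Y (2 * 1) →ₗ[ℂ] complexBetti X (2 * 1), IsCohomologicalIsogeny Y X g' ∧
      (∀ a ∈ transcendentalSubspace X, g' (g a) = a) ∧
      (∀ b ∈ transcendentalSubspace Y, g (g' b) = b) := by
  classical
  set TX := transcendentalSubspace X with hTX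
  set TY := transcendentalSubspace Y with hTY
  -- the restriction of `g` to `T(X) → T(Y)` is a linear bijection
  have hmaps : ∀ a ∈ TX, g a ∈ TY := fun a ha ↦ h.map_mem ha
  let gT : TX →ₗ[ℂ] TY := g.restrict hmaps
  have hgT_apply : ∀ a : TX, (gT a : complexBetti Y (2 * 1)) = g a := fun a ↦ rfl
  have hbij : Function.Bijective gT := by
    refine ⟨fun a₁ a₂ hEq ↦ ?_, fun b ↦ ?_⟩
    · apply Subtype.ext
      exact h.bijOn.injOn a₁.2 a₂.2 (by
        have := congrArg (fun z : TY ↦ (z : complexBetti Y (2 * 1))) hEq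
        simpa [hgT_apply] using this)
    · obtain ⟨a, ha, hab⟩ := h.bijOn.surjOn b.2
      exact ⟨⟨a, ha⟩, Subtype.ext (by rw [hgT_apply]; exact hab)⟩
  let e : TX ≃ₗ[ℂ] TY := LinearEquiv.ofBijective gT hbij
  have he_apply : ∀ a : TX, (e a : complexBetti Y (2 * 1)) = g a := fun a ↦ rfl
  -- a linear projection onto `T(Y)`
  obtain ⟨Q, hQ⟩ := TY.exists_isCompl
  let π : complexBetti Y (2 * 1) →ₗ[ℂ] TY := Submodule.projectionOnto TY Q hQ
  have hπ : ∀ b (hb : b ∈ TY), π b = ⟨b, hb⟩ := fun b hb ↦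
    Submodule.projectionOnto_apply_left hQ ⟨b, hb⟩
  let g' : complexBetti Y (2 * 1) →ₗ[ℂ] complexBetti X (2 * 1) :=
    TX.subtype ∘ₗ e.symm.toLinearMap ∘ₗ π
  have hg'_apply : ∀ b (hb : b ∈ TY), g' b = (e.symm ⟨b, hb⟩ : complexBetti X (2 * 1)) := by
    intro b hb
    simp only [g', LinearMap.coe_comp, Function.comp_apply, Submodule.coe_subtype, LinearEquiv.coe_coe,
      hπ b hb]
  have hg'_mem : ∀ b ∈ TY, g' b ∈ TX := fun b hb ↦ by
    rw [hg'_apply b hb]; exact Subtype.coe_prop _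
  -- the two inverse identities
  have hright : ∀ b ∈ TY, g (g' b) = b := by
    intro b hb
    rw [hg'_apply b hb, ← he_apply, LinearEquiv.apply_symm_apply]
  have hleft : ∀ a ∈ TX, g' (g a) = a := by
    intro a ha
    have hga : g a ∈ TY := hmaps a ha
    rw [hg'_apply _ hga]
    have : (⟨g a, hga⟩ : TY) = e ⟨a, ha⟩ := Subtype.ext (by rw [he_apply])
    rw [this, LinearEquiv.symm_apply_apply]
  refine ⟨g', ⟨⟨hg'_mem, ?_, ?_⟩, ?_, ?_, ?_⟩, hleft, hright⟩
  · -- injective on `T(Y)`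
    intro b₁ hb₁ b₂ hb₂ hEq
    rw [← hright b₁ hb₁, ← hright b₂ hb₂, hEq]
  · -- onto `T(X)`
    intro a ha
    exact ⟨g a, hmaps a ha, hleft a ha⟩
  · -- rational classes of `T(Y)` go to rational classes
    intro b hb hr
    obtain ⟨a, ha, har, rfl⟩ := h.exists_isRationalClass_eq hb hr
    rw [hleft a ha]
    exact har
  · -- onto the rational classes of `T(X)`
    intro a ha hr
    exact ⟨g a, hmaps a ha, h.isRationalClass_map ha hr, hleft a ha⟩
  · -- Hodge types
    intro i j b hb hb'
    have hmem : g' b ∈ TX := hg'_mem b hb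
    refine h.isOfHodgeType_of_map hX hY hmem ?_
    rw [hright b hb]
    exact hb'

/-- **The cell's Prop shape** (`InverseIsogeny` of hodge-nonav ROUTE-P1L Sketch, verbatim): every
cohomological isogeny between smooth projective surfaces has an inverse cohomological isogeny on the
transcendental parts — a THEOREM (`IsCohomologicalIsogeny.exists_inverse`).
[cite: Morrison1987Isogenies, §1 Definition (p. 181)] -/
theorem inverseIsogeny :
    ∀ ⦃X Y : Motives.SchemeOver ℂ⦄, Motives.IsSmoothProjective 2 X → Motives.IsSmoothProjective 2 Y →
      ∀ g : complexBetti X (2 * 1) →ₗ[ℂ] complexBetti Y (2 * 1), IsCohomologicalIsogeny X Y g →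
        ∃ g' : complexBetti Y (2 * 1) →ₗ[ℂ] complexBetti X (2 * 1), IsCohomologicalIsogeny Y X g' ∧
          (∀ a ∈ transcendentalSubspace X, g' (g a) = a) ∧
          (∀ b ∈ transcendentalSubspace Y, g (g' b) = b) :=
  fun _ _ hX hY _ hg ↦ hg.exists_inverse hX hY

end Inverse

end Literature.AlgebraicGeometry.Surfaces

end
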